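import Mathlib
import HarnessLib
import Summits.HubbardSuperconductivity.HubbardSuperconductivity.Theorems.KLProgrammeKLRegimeVolumeLimitTranslationInvariance

/-!
# The `U`-linear (Hartree) term of the bare-frame VL carrier is `U` times t2's TIME-ZERO local insertion (seat hubbard-kl-k3c5-p2, g2)

Route `KLProgramme`, gen-4 child 5 `KLRegimeVolumeLimitV12` (stmt-HubbardSuperconductivity-19858), `stub_vl_bound`, TAU-BRIDGE §6 Step 2 / §7.
`…DysonHartreeCurrent`: `Σ̂⁰_{L,M}(k,σ) = (βL²/Z)·(U(βL²)⁻³∫e^{−V}Σ_qψ̂⁺_{qσ̄}ψ̂⁻_{qσ̄} + U²·…)`; `…HartreeAverage`: the first term is `U(βL²)⁻²` times the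
space–time integral of the local insertion; `…TranslationInvariance`: the local insertion is constant in space–time at every finite cutoff.  Hence

  `(βL²/Z)·U(βL²)⁻³·∫dμ_C e^{−V}Σ_qψ̂⁺_{qσ}ψ̂⁻_{qσ} = U · ∫dμ_C ψ⁺_{(0,0)σ}ψ⁻_{(0,0)σ}e^{−V} / Z`

(`hartree_term_eq_local`) — `U` times EXACTLY the normalised time-zero local insertion whose `M → ∞` limit for every `U` is t2's
`tendsto_grassmannTwoPoint_eq_hubbardThermalTwoPoint_sub_allU` (value `hubbardThermalTwoPoint β U (μ+U/2) L 0 0 σ σ − ½`).  Everything is proved;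
no definition.
-/

noncomputable section

namespace Summit.HubbardSuperconductivity.HubbardSuperconductivity.Theorems.TwoPointAssembly

set_option linter.dupNamespace false -- summit = problem name (single-conjunct summit), D-0017

open Finset MeasureTheory Literature.MathematicalPhysics.QuantumLattice Literature.Probability.LatticeModels GrassmannAlgebra

variable {L M : ℕ} [NeZero L]

/-- **HARTREE TERM = U × THE TIME-ZERO LOCAL INSERTION** (bare frame, finite cutoff, `β > 0`, every real `U`, any spin `σ`, any `Z`). -/
theorem hartree_term_eq_local {β : ℝ} (hβ : 0 < β) (U μ : ℝ) (σ : Fin 2) (Z : ℂ) :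
    ((β * (L : ℝ) ^ 2 : ℝ) : ℂ) / Z *
        ((U : ℂ) * (((1 / (β * (L : ℝ) ^ 2) ^ 3 : ℝ) : ℂ)) *
          gaussExpect ℂ (hubbardCovarianceCT L M β μ 0 0)
            (grassmannExp (-(hubbardInteraction L M β U)) * ∑ q : FreqMomentum L M, psiPlus q σ * psiMinus q σ)) =
      (U : ℂ) * (gaussExpect ℂ (hubbardCovariance L M β μ 0)
        (positionField L M β 0 σ 0 0 * positionField L M β 1 σ 0 0 * grassmannExp (-(hubbardInteraction L M β U))) / Z) := by
  have hβL : ((β * (L : ℝ) ^ 2 : ℝ) : ℂ) ≠ 0 := by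
    have hL : (L : ℝ) ≠ 0 := by exact_mod_cast NeZero.ne L
    exact_mod_cast mul_ne_zero hβ.ne' (pow_ne_zero 2 hL)
  rw [hartree_term_eq_spacetime_average hβ, hubbardCovarianceCT_zero_frame]
  set G : ℂ := gaussExpect ℂ (hubbardCovariance L M β μ 0)
    (positionField L M β 0 σ 0 0 * positionField L M β 1 σ 0 0 * grassmannExp (-(hubbardInteraction L M β U))) with hG
  -- the local insertion is constant in space–time
  have hconst : ∀ (x : TorusSite 2 L) (t : ℝ), gaussExpect ℂ (hubbardCovariance L M β μ 0)
      (positionField L M β 0 σ x t * positionField L M β 1 σ x t * grassmannExp (-(hubbardInteraction L M β U))) = G := by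
    intro x t
    have h := gaussExpect_localPair_translate (L := L) (M := M) β U μ t x 0 0 σ
    simpa using h
  simp_rw [hconst, setIntegral_const, Finset.sum_const, Finset.card_univ]
  have hvol : (volume : Measure ℝ).real (Set.Icc (0 : ℝ) β) = β := by rw [Real.volume_real_Icc_of_le hβ.le, sub_zero]
  rw [hvol]
  have hcard : (Fintype.card (TorusSite 2 L) : ℂ) = (L : ℂ) ^ 2 := by
    rw [Fintype.card_pi, prod_const, ZMod.card, card_univ, Fintype.card_fin, Nat.cast_pow]
  rw [nsmul_eq_mul, hcard, Complex.real_smul]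
  have hβc : (β : ℂ) ≠ 0 := by exact_mod_cast hβ.ne'
  have hLc : (L : ℂ) ≠ 0 := by exact_mod_cast NeZero.ne L
  rcases eq_or_ne Z 0 with hZ | hZ
  · simp [hZ]
  · push_cast
    field_simp
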